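import Mathlib
import HarnessLib
import Summits.Ventures.LatticeQCDFlow.Exactness.LatticeBlockEntropyFloor
import Summits.Ventures.LatticeQCDFlow.Exactness.CenteredExponentialMomentVarianceFloor

/-!
# The reverse relative-entropy floor of an independence sampler on a lattice of compact sites, in variance form: `Σ_j log(1 + Var_π(A_C h_j)/(2 + M_j)) − 2δ ≤ ∫F dπ + log∫e^{−F}dπ = KL(π ‖ π.tilted(−F))` for a log-weight within `δ` of a sum of block-local terms

HONEST FRAMING: exact (Metropolis-corrected) sampling algorithms for lattice gauge theory;
figures of merit are autocorrelation/cost numbers at stated couplings and volumes; no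
continuum-physics claim.

Venture `LatticeQCDFlow` (cell pub-lqcd), topic `Exactness`; FANOUT row 7 (`s0-cpn-null`).  NEW WORK
of the cell over this lineage's `Exactness/LatticeBlockEntropyFloor.lean` (GEN-17: the block
tensorization `Σ_j(∫h_j + log∫e^{−A_C h_j}) − 2δ ≤ ∫F + log∫e^{−F}` on a finite product of compact
probability spaces, blocks `B_j`, corridor `C`) and `Exactness/CenteredExponentialMomentVarianceFloor.lean`
(GEN-17: `log(1 + Var(G)/(2 + M)) ≤ log∫e^{−(G − ∫G)}` for `G − ∫G ≤ M`), with
`Exactness/LatticeCoordAvg.lean`; nothing is cited as a fact.  Printed counterparts, NAMED ONLY: the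
reverse-KL training objective of flow samplers (Albergo–Kanwar–Shanahan 2019 §II; Nicoli et al. 2020);
Abbott et al. 2022 §V; the venture's barrier B1 `Scaling/Barriers.VolumeScalingOfTraining` (theory-2:
FORWARD entropy, finite state spaces, product-prior flows, block defect a hypothesis).  THE GENERIC FORM
IN THE BLOCK FORMAT OF THE SAMPLER-QUALITY FILES.  Sites `ι` (finite), compact metric site space `X`
with a Borel probability measure `μ`, `π = ⊗_ι μ`, a continuous log-weight `F` on `Ω = X^ι` (target
`π.tilted(−F)`; `∫F dπ + log∫e^{−F}dπ` is the relative entropy `KL(π ‖ π.tilted(−F))` of the PROPOSAL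
from the TARGET — in flowed coordinates, the reverse-KL training objective of an exact flow sampler).
If `F` is within `δ` of `Σ_j h_j + r` with `h_j` continuous, depending on pairwise disjoint sets
`D_j ⊇ B_j`, of oscillation `≤ M_j`, and `r` continuous depending on the complement of `⋃_j B_j`, then
with `C = ι ∖ ⋃_j B_j`:  `Σ_j log(1 + Var_π(A_C h_j)/(2 + M_j)) − 2δ ≤ ∫F dπ + log∫e^{−F}dπ` — the
training objective of a fixed-receptive-field exact sampler is at least a SUM over blocks of
non-negative terms, positive at every block whose corridor-conditional mean `A_C h_j` is not constant:
LINEAR IN THE NUMBER OF NON-DEGENERATE BLOCKS, on continuous compact configuration spaces and without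
product structure of the target.  This completes the generic quartet of this lineage (KL here; ESS
`LatticeBlockSecondMomentTensorization`; acceptance `LatticeIndependenceSamplerAcceptanceCeiling`;
`τ_int` `LatticeIndependenceSamplerEventTauInt`); the lattice-of-spheres / exact-LO-flow instances are
`SphereLOFlowEntropyFloor*` and `Torus*EntropyFloor`.

## Content

* `coordAvg_sub_integral_le_of_osc` — `A_C h(ω) − ∫h dπ ≤ M` when `|h(ω) − h(ω')| ≤ M`.
* **`latticeIndep_sum_log_one_add_variance_sub_le`** — the displayed inequality.

NOT CLAIMED: the identification of the right side with Mathlib's `klDiv` (done for the lattice of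
spheres in `SphereFlowRelativeEntropy`); non-compact sites; anything model-specific; numbers.
-/

noncomputable section

namespace Summit.Ventures.LatticeQCDFlow.Exactness

open Function Set Metric MeasureTheory
open scoped Topology

variable {ι : Type*} [Fintype ι] [DecidableEq ι]
variable {X : Type*} [MeasurableSpace X] [MetricSpace X] [CompactSpace X] [BorelSpace X]
  (μ : Measure X) [IsProbabilityMeasure μ]

/-- **Oscillation bound for the corridor average**: if `|h(ω) − h(ω')| ≤ M` for all `ω, ω'`, then
`A_s h(ω) − ∫h dπ ≤ M` for every `s` and `ω`. -/
theorem coordAvg_sub_integral_le_of_osc (s : Finset ι) {h : (ι → X) → ℝ} (hc : Continuous h) {M : ℝ}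
    (hM : ∀ ω ω', |h ω - h ω'| ≤ M) (ω : ι → X) :
    coordAvg μ s h ω - ∫ ω', h ω' ∂Measure.pi (fun _ : ι => μ) ≤ M := by
  have hcg : Continuous fun ω' : ι → X => h (s.piecewise ω' ω) :=
    hc.comp ((continuous_piecewise_prod s).comp (Continuous.prodMk_right ω))
  unfold coordAvg
  rw [← integral_sub (integrable_pi_of_continuous μ hcg) (integrable_pi_of_continuous μ hc)]
  calc ∫ ω', (h (s.piecewise ω' ω) - h ω') ∂Measure.pi (fun _ : ι => μ)
      ≤ ∫ _ω', M ∂Measure.pi (fun _ : ι => μ) :=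
        integral_mono ((integrable_pi_of_continuous μ hcg).sub (integrable_pi_of_continuous μ hc))
          (integrable_const M) fun ω' => (le_abs_self _).trans (hM _ _)
    _ = M := by rw [integral_const, smul_eq_mul, probReal_univ, one_mul]

/-- **THE REVERSE RELATIVE-ENTROPY FLOOR IN VARIANCE FORM (compact sites).**  Blocks `B_j ⊆ D_j` with
the `D_j` pairwise disjoint (`j ∈ T`); `h_j` continuous, depending on `D_j`, with oscillation `≤ M_j`
(`0 ≤ M_j`); `r` continuous depending on the complement of `⋃_j B_j`; `C = ι ∖ ⋃_j B_j`; a continuous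
log-weight `F` with `|F − (Σ_j h_j + r)| ≤ δ`.  Then
`Σ_j log(1 + ∫(A_C h_j − ∫h_j)²dπ/(2 + M_j)) − 2δ ≤ ∫F dπ + log∫e^{−F}dπ`. -/
theorem latticeIndep_sum_log_one_add_variance_sub_le {J : Type*} (T : Finset J) (B D : J → Finset ι)
    (hBD : ∀ j ∈ T, B j ⊆ D j) (hD : ∀ j ∈ T, ∀ j' ∈ T, j ≠ j' → Disjoint (D j) (D j'))
    {h : J → (ι → X) → ℝ} (hc : ∀ j ∈ T, Continuous (h j))
    (hdep : ∀ j ∈ T, DependsOn (h j) ↑(D j))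
    {M : J → ℝ} (hM0 : ∀ j ∈ T, 0 ≤ M j) (hM : ∀ j ∈ T, ∀ ω ω', |h j ω - h j ω'| ≤ M j)
    {r : (ι → X) → ℝ} (hr : Continuous r) (hrdep : DependsOn r (↑(T.biUnion B) : Set ι)ᶜ)
    {F : (ι → X) → ℝ} (hF : Continuous F) {δ : ℝ}
    (hδ : ∀ ω, |F ω - (∑ j ∈ T, h j ω + r ω)| ≤ δ) :
    ∑ j ∈ T, Real.log (1 + (∫ ω, (coordAvg μ (Finset.univ \ T.biUnion B) (h j) ω -
        ∫ ω', h j ω' ∂Measure.pi (fun _ : ι => μ)) ^ 2 ∂Measure.pi (fun _ : ι => μ)) / (2 + M j)) - 2 * δ ≤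
      (∫ ω, F ω ∂Measure.pi (fun _ : ι => μ)) +
        Real.log (∫ ω, Real.exp (-F ω) ∂Measure.pi (fun _ : ι => μ)) := by
  set π : Measure (ι → X) := Measure.pi (fun _ : ι => μ) with hπ
  set C : Finset ι := Finset.univ \ T.biUnion B with hC
  -- the block format of `LatticeBlockEntropyFloor`
  have hB : ∀ j ∈ T, ∀ j' ∈ T, j ≠ j' → Disjoint (B j) (B j') := fun j hj j' hj' hne =>
    Finset.disjoint_of_subset_left (hBD j hj) (Finset.disjoint_of_subset_right (hBD j' hj') (hD j hj j' hj' hne))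
  have hdep' : ∀ j ∈ T, DependsOn (h j) (↑(B j) ∪ ↑C) := by
    intro j hj
    refine (hdep j hj).mono fun i hi => ?_
    by_cases his : i ∈ T.biUnion B
    · left
      obtain ⟨j', hj', hij'⟩ := Finset.mem_biUnion.1 his
      by_cases hjj : j = j'
      · subst hjj; exact hij'
      · exact absurd (Finset.disjoint_left.1 (hD j hj j' hj' hjj) (Finset.mem_coe.1 hi) (hBD j' hj' hij')) id
    · right
      exact Finset.mem_coe.2 (Finset.mem_sdiff.2 ⟨Finset.mem_univ _, his⟩)
  have hrC : DependsOn r ↑C := by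
    intro ω ω' hag
    refine hrdep fun i hi => hag i ?_
    exact Finset.mem_coe.2 (Finset.mem_sdiff.2 ⟨Finset.mem_univ _, fun h' => hi (Finset.mem_coe.2 h')⟩)
  have hQ := sum_blocks_sub_le_integral_add_log_integral_exp_neg μ T B hB C hc hdep' hr hrC hF hδ
  refine le_trans (sub_le_sub_right (Finset.sum_le_sum fun j hj => ?_) _) hQ
  -- per block: `log(1 + Var(A_C h_j)/(2 + M_j)) ≤ ∫h_j + log∫e^{−A_C h_j}`
  have hGc : Continuous (coordAvg μ C (h j)) := continuous_coordAvg μ C (hc j hj)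
  have hGi : Integrable (coordAvg μ C (h j)) π := integrable_pi_of_continuous μ hGc
  have hG2 : Integrable (fun ω => coordAvg μ C (h j) ω ^ 2) π := integrable_pi_of_continuous μ (hGc.pow 2)
  have hGe : Integrable (fun ω => Real.exp (-coordAvg μ C (h j) ω)) π :=
    integrable_pi_of_continuous μ hGc.neg.rexp
  have hmean : ∫ ω, coordAvg μ C (h j) ω ∂π = ∫ ω, h j ω ∂π := integral_coordAvg μ C (hc j hj)
  have hGM : ∀ ω, coordAvg μ C (h j) ω - ∫ ω', coordAvg μ C (h j) ω' ∂π ≤ M j := fun ω => by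
    rw [hmean]; exact coordAvg_sub_integral_le_of_osc μ C (hc j hj) (hM j hj) ω
  have hR := log_one_add_variance_div_le_log_integral_exp_neg_sub_mean hGi hG2 hGe (hM0 j hj) hGM
  rw [hmean] at hR
  refine hR.trans (le_of_eq ?_)
  -- `log ∫ e^{−(G − m)} = m + log ∫ e^{−G}`
  have hpos : 0 < ∫ ω, Real.exp (-coordAvg μ C (h j) ω) ∂π := integral_exp_pos hGe
  have e : ∫ ω, Real.exp (-(coordAvg μ C (h j) ω - ∫ ω', h j ω' ∂π)) ∂π =
      Real.exp (∫ ω', h j ω' ∂π) * ∫ ω, Real.exp (-coordAvg μ C (h j) ω) ∂π := by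
    rw [← integral_const_mul]
    refine integral_congr_ae (ae_of_all _ fun ω => ?_)
    show Real.exp (-(coordAvg μ C (h j) ω - ∫ ω', h j ω' ∂π)) =
      Real.exp (∫ ω', h j ω' ∂π) * Real.exp (-coordAvg μ C (h j) ω)
    rw [← Real.exp_add]; congr 1; ring
  rw [e, Real.log_mul (Real.exp_pos _).ne' hpos.ne', Real.log_exp]

end Summit.Ventures.LatticeQCDFlow.Exactness

end
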